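import Mathlib
import Summits.NavierStokesRegularity.NavierStokesRegularity.Theorems.SubOnsagerCeilingOrthantTailCeiling.Negative.OrthantTailCeilingFalseOfSideBranchCriticalEscapeEstimate
import Summits.NavierStokesRegularity.NavierStokesRegularity.Theorems.SubOnsagerCeilingForwardTailCeilingTwinReduction
import HarnessLib

/-!
# `SubOnsagerCeiling.ForwardTailCeiling` (stmt-NavierStokesRegularity-26608) — negative lemma modulo the
# ONSAGER-CRITICAL escape estimate of the side-branch table (`SideBranchCriticalEscapeEstimate`)

Composition of two kernel facts of the tree:

* `forwardTailCeiling_imp_ceilingAt_sideBranchTable` (prover ns-ow-p1 g4,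
  `Theorems/SubOnsagerCeilingForwardTailCeilingTwinReduction.lean`): the forward-source ceiling
  `ForwardTailCeiling` implies, at every scale ratio `ε₀ ∈ (0,1]`, the per-table body
  `CeilingAt 10 ε₀ sideBranchTable` of the aside crux `OrthantTailCeiling` on its own witness table
  `α_SB` (twin-table embedding: `twin-α_SB ∈ E₂(17)` is all-source, `S = univ` forced);
* `not_ceilingAt_sideBranch_of_criticalEscapeEstimate` (this seat,
  `Theorems/SubOnsagerCeilingOrthantTailCeiling/Negative/OrthantTailCeilingFalseOfSideBranchCriticalEscapeEstimate.lean`):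
  that body fails as soon as, at infinitely many depths `K`, the block `0..K` of `α_SB` loses the
  ONSAGER-CRITICAL amount `c·(1+ε₀)^{-K}·E₀` within a depth-dependent horizon at small viscosity
  (`SideBranchCriticalEscapeEstimateAt ε₀`; an a priori estimate, `Prop`, NOTHING asserted) — a
  sub-Onsager ceiling bounds the tail `K+1..K'` by `C E₀ (1+ε₀)^{-2θ(K+1)}` and, through the pocket /
  side meters of record, the loss of the deeper block `0..K'` by `o(1)`; `2θ > 1` does the rest.

Hence **`ForwardTailCeiling_false_of_SideBranchCriticalEscapeEstimate :
SideBranchCriticalEscapeEstimate → ¬ ForwardTailCeiling`** (the crux BY NAME), superseding the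
`SideBranchEscape` version `forwardTailCeiling_false_of_sideBranchEscape` (fixed fraction, fixed horizon,
all depths). The class-restricted restatement `ForwardTailCeilingKP` (diagonal feeds, item 27057) is NOT
touched: `α_SB`'s twin uses a differential feed.

HONEST FRAMING: MODEL lattice ODEs only (Tao 2016 §4 vocabulary; rung TL-M2Break); a conditional
refutation; it settles nothing by itself and no summit is proved; nothing here is a statement about
the Navier–Stokes equations. [cite: Tao2016AveragedNS, §4 (4.2)–(4.3), (4.5), (4.8)]
-/

noncomputable section

-- the sub-problem namespace `NavierStokesRegularity.NavierStokesRegularity` is the tree's layout (D-0017)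
set_option linter.dupNamespace false

namespace Summit.NavierStokesRegularity.NavierStokesRegularity.Theorems.SubOnsagerCeiling

open Summit.NavierStokesRegularity.NavierStokesRegularity.Theses.SubOnsagerCeiling

/-- **`SideBranchCriticalEscapeEstimateAt ε₀ → ¬ ForwardTailCeiling`** for any `ε₀ ∈ (0,1]`: the
forward-source ceiling would give `CeilingAt 10 ε₀ sideBranchTable` (twin reduction), which the
Onsager-critical escape estimate refutes (`not_ceilingAt_sideBranch_of_criticalEscapeEstimate`).
MODEL lattice only; conditional. [this file] -/
theorem forwardTailCeiling_false_of_sideBranchCriticalEscapeEstimateAt {ε₀ : ℝ} (hε : 0 < ε₀)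
    (hε1 : ε₀ ≤ 1) (hH : SideBranchCriticalEscapeEstimateAt ε₀) : ¬ ForwardTailCeiling := fun h =>
  not_ceilingAt_sideBranch_of_criticalEscapeEstimate hε hH
    (forwardTailCeiling_imp_ceilingAt_sideBranchTable h hε hε1)

/-- **Negative lemma (conditional refutation of the crux BY NAME, Onsager-critical form).**
`SideBranchCriticalEscapeEstimate → ¬ ForwardTailCeiling`. MODEL lattice only; conditional; settles
nothing by itself. [this file] -/
theorem forwardTailCeiling_false_of_sideBranchCriticalEscapeEstimate
    (hH : SideBranchCriticalEscapeEstimate) : ¬ ForwardTailCeiling := by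
  obtain ⟨ε₀, hε, hε1, hHε⟩ := hH
  exact forwardTailCeiling_false_of_sideBranchCriticalEscapeEstimateAt hε hε1 hHε

/-- Gate-shaped alias (`<Decl>_false_of_<H>`): `SideBranchCriticalEscapeEstimate → ¬ ForwardTailCeiling`.
MODEL lattice only; conditional; settles nothing by itself. [this file] -/
theorem ForwardTailCeiling_false_of_SideBranchCriticalEscapeEstimate :
    SideBranchCriticalEscapeEstimate → ¬ ForwardTailCeiling :=
  forwardTailCeiling_false_of_sideBranchCriticalEscapeEstimate

end Summit.NavierStokesRegularity.NavierStokesRegularity.Theorems.SubOnsagerCeiling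

end
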